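import Summits.QuantumAdvantage.AdviceFreeQNC0.BondTwistLocal
import HarnessLib

/-!
# Cell qa-qnc0, `p = 3` — RIGIDITY of the bond-twisted block (planner qa-qnc0-p1 g20, ask P-20e; ROUND-19 §3
"2-cycle argument"; `exp20/Sketch20x.lean` §7)

The combinatorial heart of the BLOCK LEMMA `blockOpR_contracts` (`BlockLemma.lean`): on the register chain
(`BondTwistLocal.lean`) a chain of site operators `T_0 ∘ ⋯ ∘ T_{2r}` whose first phase `ζ` is a primitive cube root and
whose later phases are unimodular admits NO nonzero norm-preserved vector (`chain_rigid`):

* norm equality forces alignment at every stage (`chainAligned_of_le`, from `siteOpR_aligned_of_rnsq_eq`);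
* under alignment the chain transports `f` along every bit string: `(T_0⋯T_m f)(σ) = Φ_w · (±1) · f(σ·w)`
  (`chainOp_eq_of_aligned`), `Φ_w` the product of the phases read on the `1`-bits;
* after `2r+1` bits the register is flushed (`run_congr_reg`), so `σ·(0,w) = σ'·(1,w)` and `σ·(1,w) = σ'·(0,w)` for the
  spin-reversed start `σ'` (`run_false_cons`); the two transport identities from `σ` and `σ'` close a 2-cycle with
  multiplier `ζ^2·(±1) ≠ 1`, whence `f(σ·(1,w)) = 0` (`apply_run_eq_zero`); every state is of that form (`exists_run_eq`).

WHAT THIS IS NOT: no norm bound yet (compactness step in `BlockLemma.lean`); crux 22907 untouched; separation NOT moved.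
-/

namespace Summit.QuantumAdvantage.AdviceFreeQNC0

open Finset Literature.Computability.QuantumComplexity

namespace BondTwist3

variable {r : ℕ}

/-! ## Chains of site operators -/

/-- A chain of site operators `T_{p₀} ∘ T_{p₁} ∘ ⋯` (phases `p.1`, sign patterns `p.2`). -/
noncomputable def chainOp (l : List (ℂ × (RegState r → Bool → Bool))) (f : RegState r → ℂ) : RegState r → ℂ :=
  l.foldr (fun p g => siteOpR p.1 p.2 g) f

/-- The empty chain is the identity. -/
theorem chainOp_nil (f : RegState r → ℂ) : chainOp [] f = f := rfl

/-- Unfolding one site. -/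
theorem chainOp_cons (p : ℂ × (RegState r → Bool → Bool)) (l : List (ℂ × (RegState r → Bool → Bool)))
    (f : RegState r → ℂ) : chainOp (p :: l) f = siteOpR p.1 p.2 (chainOp l f) := rfl

/-- The block operator is the chain `(ζ, ε 0) :: (ω j, ε (j+1))_j`. -/
theorem blockOpR_eq_chainOp (ζ : ℂ) (ω : Fin (2 * r) → ℂ) (ε : Fin (2 * r + 1) → RegState r → Bool → Bool)
    (f : RegState r → ℂ) :
    blockOpR ζ ω ε f = chainOp ((ζ, ε 0) :: List.ofFn fun j : Fin (2 * r) => (ω j, ε j.succ)) f := rfl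

/-- A chain of contractions is a contraction. -/
theorem rnsq_chainOp_le (l : List (ℂ × (RegState r → Bool → Bool))) (hl : ∀ p ∈ l, ‖p.1‖ ≤ 1)
    (f : RegState r → ℂ) : rnsq (chainOp l f) ≤ rnsq f := by
  induction l with
  | nil => exact le_rfl
  | cons p l ih =>
    rw [chainOp_cons]
    exact (rnsq_siteOpR_le (hl p (by simp)) _ _).trans (ih fun q hq => hl q (by simp [hq]))

/-- Chains are homogeneous. -/
theorem chainOp_smul (l : List (ℂ × (RegState r → Bool → Bool))) (a : ℂ) (f : RegState r → ℂ) :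
    chainOp l (fun τ => a * f τ) = fun σ => a * chainOp l f σ := by
  induction l with
  | nil => rfl
  | cons p l ih =>
    rw [chainOp_cons, chainOp_cons, ih]
    funext σ
    simp only [siteOpR]
    ring

/-- Full alignment of `f` along the chain `l`: every stage is aligned at every state. -/
def ChainAligned : List (ℂ × (RegState r → Bool → Bool)) → (RegState r → ℂ) → Prop
  | [], _ => True
  | p :: l, f => (∀ σ, brL p.2 (chainOp l f) σ = brR p.1 p.2 (chainOp l f) σ) ∧ ChainAligned l f

/-- Norm preservation along a chain of contractions forces full alignment. -/
theorem chainAligned_of_le (l : List (ℂ × (RegState r → Bool → Bool))) (hl : ∀ p ∈ l, ‖p.1‖ ≤ 1)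
    (f : RegState r → ℂ) (heq : rnsq f ≤ rnsq (chainOp l f)) : ChainAligned l f := by
  induction l with
  | nil => trivial
  | cons p l ih =>
    have hp : ‖p.1‖ ≤ 1 := hl p (by simp)
    have hl' : ∀ q ∈ l, ‖q.1‖ ≤ 1 := fun q hq => hl q (by simp [hq])
    rw [chainOp_cons] at heq
    have h1 := rnsq_siteOpR_le hp p.2 (chainOp l f)
    have h2 := rnsq_chainOp_le l hl' f
    exact ⟨fun σ => siteOpR_aligned_of_rnsq_eq hp p.2 (chainOp l f) (by linarith) σ, ih hl' (by linarith)⟩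

/-! ## Runs of the register chain -/

/-- Reading a bit string. -/
def run (σ : RegState r) (bs : List Bool) : RegState r := bs.foldl nextState σ

/-- Reading nothing. -/
theorem run_nil (σ : RegState r) : run σ [] = σ := rfl

/-- Reading the first bit. -/
theorem run_cons (σ : RegState r) (b : Bool) (bs : List Bool) : run σ (b :: bs) = run (nextState σ b) bs := rfl

/-- The product of the phases read on the `1`-bits. -/
noncomputable def phaseProd : List (ℂ × (RegState r → Bool → Bool)) → List Bool → ℂ
  | p :: l, b :: bs => (if b then p.1 else 1) * phaseProd l bs
  | _, _ => 1

/-- Nonzero phases give a nonzero product. -/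
theorem phaseProd_ne_zero (l : List (ℂ × (RegState r → Bool → Bool))) (hl : ∀ p ∈ l, p.1 ≠ 0) (bs : List Bool) :
    phaseProd l bs ≠ 0 := by
  induction l generalizing bs with
  | nil => cases bs <;> simp [phaseProd]
  | cons p l ih =>
    cases bs with
    | nil => simp [phaseProd]
    | cons b bs =>
      simp only [phaseProd]
      refine mul_ne_zero ?_ (ih (fun q hq => hl q (by simp [hq])) bs)
      cases b
      · simp
      · simpa using hl p (by simp)

/-- The sign factors are `±1`. -/
theorem sgn_cases (b : Bool) : (if b then (-1 : ℂ) else 1) = 1 ∨ (if b then (-1 : ℂ) else 1) = -1 := by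
  cases b <;> simp

/-- **Transport under alignment**: `(T_0⋯T_m f)(σ) = Φ_w · θ · f(σ·w)` with `θ = ±1`, for every bit string `w` of the
chain's length. -/
theorem chainOp_eq_of_aligned (l : List (ℂ × (RegState r → Bool → Bool))) (f : RegState r → ℂ)
    (hal : ChainAligned l f) (σ : RegState r) (bs : List Bool) (hlen : bs.length = l.length) :
    ∃ θ : ℂ, (θ = 1 ∨ θ = -1) ∧ chainOp l f σ = phaseProd l bs * θ * f (run σ bs) := by
  induction l generalizing σ bs with
  | nil =>
    cases bs with
    | nil => exact ⟨1, Or.inl rfl, by simp [chainOp_nil, phaseProd, run_nil]⟩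
    | cons b bs => simp at hlen
  | cons p l ih =>
    cases bs with
    | nil => simp at hlen
    | cons b bs =>
      have hlen' : bs.length = l.length := by simpa using hlen
      have hσ := hal.1 σ
      have hT : chainOp (p :: l) f σ = brL p.2 (chainOp l f) σ := by
        rw [chainOp_cons]; exact siteOpR_eq_brL_of_aligned hσ
      obtain ⟨θ', hθ', e'⟩ := ih hal.2 (nextState σ b) bs hlen'
      cases b with
      | false =>
        refine ⟨(if p.2 σ false then (-1 : ℂ) else 1) * θ', ?_, ?_⟩
        · rcases sgn_cases (p.2 σ false) with h | h <;> rcases hθ' with rfl | rfl <;> simp [h]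
        · rw [hT, brL, e', run_cons]
          simp only [phaseProd, Bool.false_eq_true, if_false]
          ring
      | true =>
        refine ⟨(if p.2 σ true then (-1 : ℂ) else 1) * θ', ?_, ?_⟩
        · rcases sgn_cases (p.2 σ true) with h | h <;> rcases hθ' with rfl | rfl <;> simp [h]
        · rw [hT, hσ, brR, e', run_cons]
          simp only [phaseProd, if_true]
          ring

/-- **Register flush**: registers agreeing on the positions `≥ 2r − k` give identical runs on `≥ 2r − k` more bits. -/
theorem run_congr_reg (W : List Bool) : ∀ (P : ZMod 3) (t : Bool) (ρ₁ ρ₂ : Fin (2 * r) → Bool) (k : ℕ),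
    (∀ j : Fin (2 * r), 2 * r ≤ j.val + k → ρ₁ j = ρ₂ j) → 2 * r ≤ k + W.length →
    run ((P, t, ρ₁) : RegState r) W = run ((P, t, ρ₂) : RegState r) W := by
  induction W with
  | nil =>
    intro P t ρ₁ ρ₂ k hagree hk
    have : ρ₁ = ρ₂ := funext fun j => hagree j (by simp at hk; omega)
    rw [this]
  | cons b W ih =>
    intro P t ρ₁ ρ₂ k hagree hk
    rw [run_cons, run_cons]
    show run ((P + spinZ (if b then t else !t), (if b then t else !t), shiftIn ρ₁ b) : RegState r) W =
      run ((P + spinZ (if b then t else !t), (if b then t else !t), shiftIn ρ₂ b) : RegState r) W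
    refine ih _ _ (shiftIn ρ₁ b) (shiftIn ρ₂ b) (k + 1) (fun j hj => ?_)
      (by simp only [List.length_cons] at hk; omega)
    simp only [shiftIn]
    split_ifs with h
    · exact hagree ⟨j.val + 1, h⟩ (by simp only; omega)
    · rfl

/-- After `≥ 2r` bits the initial register is forgotten. -/
theorem run_reg_irrel (P : ZMod 3) (t : Bool) (ρ₁ ρ₂ : Fin (2 * r) → Bool) (W : List Bool)
    (hW : 2 * r ≤ W.length) : run ((P, t, ρ₁) : RegState r) W = run ((P, t, ρ₂) : RegState r) W :=
  run_congr_reg W P t ρ₁ ρ₂ 0 (fun j hj => absurd hj (by have := j.isLt; omega)) (by simpa using hW)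

/-- **The swap**: reading `0·w` from `(S, s)` and `1·w` from the spin-reversed `(S, ¬s)` end in the same state. -/
theorem run_false_cons (S : ZMod 3) (s : Bool) (reg : Fin (2 * r) → Bool) (W : List Bool) (hW : 2 * r ≤ W.length) :
    run ((S, s, reg) : RegState r) (false :: W) = run ((S, !s, reg) : RegState r) (true :: W) := by
  rw [run_cons, run_cons]
  have h1 : nextState ((S, s, reg) : RegState r) false = (S + spinZ (!s), !s, shiftIn reg false) := by
    simp [nextState]
  have h2 : nextState ((S, !s, reg) : RegState r) true = (S + spinZ (!s), !s, shiftIn reg true) := by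
    simp [nextState]
  rw [h1, h2]
  exact run_reg_irrel _ _ _ _ W hW

/-- Every state is reached by a run of any prescribed length. -/
theorem exists_run_eq (k : ℕ) (τ : RegState r) : ∃ (σ : RegState r) (bs : List Bool), bs.length = k ∧ run σ bs = τ := by
  induction k generalizing τ with
  | zero => exact ⟨τ, [], rfl, rfl⟩
  | succ k ih =>
    obtain ⟨σ₁, bs, hbs, hrun⟩ := ih τ
    have hbij := Finite.injective_iff_bijective.1 (nextState_lostBit_injective (r := r))
    obtain ⟨⟨σ, b⟩, hσ⟩ := hbij.2 (σ₁, true)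
    simp only [Prod.mk.injEq] at hσ
    exact ⟨σ, b :: bs, by simp [hbs], by rw [run_cons, hσ.1, hrun]⟩

/-! ## The 2-cycle -/

/-- A primitive cube root has `ζ² ∉ {±1}`. -/
theorem sq_ne_pm_one_of_cube {ζ : ℂ} (hζ3 : ζ ^ 3 = 1) (hζ1 : ζ ≠ 1) : ζ ^ 2 ≠ 1 ∧ ζ ^ 2 ≠ -1 := by
  refine ⟨fun h => hζ1 (by linear_combination hζ3 - ζ * h), fun h => ?_⟩
  have hm : ζ = -1 := by linear_combination ζ * h - hζ3
  rw [hm] at h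
  norm_num at h

/-- **The 2-cycle**: under full alignment of the block chain, `f` vanishes on every state `σ·(1,w)`, `|w| = 2r`. -/
theorem apply_run_eq_zero {ζ : ℂ} (hζ3 : ζ ^ 3 = 1) (hζ1 : ζ ≠ 1) (e : RegState r → Bool → Bool)
    (l : List (ℂ × (RegState r → Bool → Bool))) (hl : l.length = 2 * r) (hnz : ∀ p ∈ l, p.1 ≠ 0)
    (f : RegState r → ℂ) (hal : ChainAligned ((ζ, e) :: l) f)
    (S : ZMod 3) (s : Bool) (reg : Fin (2 * r) → Bool) (W : List Bool) (hW : W.length = 2 * r) :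
    f (run ((S, s, reg) : RegState r) (true :: W)) = 0 := by
  have h0 := run_false_cons S s reg W (by omega)
  have h1 := run_false_cons S (!s) reg W (by omega)
  rw [Bool.not_not] at h1
  have hlen : ∀ b : Bool, (b :: W).length = ((ζ, e) :: l).length := fun b => by simp [hW, hl]
  obtain ⟨θ₁, hθ₁, e1⟩ := chainOp_eq_of_aligned _ f hal (S, s, reg) (true :: W) (hlen true)
  obtain ⟨θ₂, hθ₂, e2⟩ := chainOp_eq_of_aligned _ f hal (S, s, reg) (false :: W) (hlen false)
  obtain ⟨θ₃, hθ₃, e3⟩ := chainOp_eq_of_aligned _ f hal (S, !s, reg) (true :: W) (hlen true)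
  obtain ⟨θ₄, hθ₄, e4⟩ := chainOp_eq_of_aligned _ f hal (S, !s, reg) (false :: W) (hlen false)
  rw [← h0] at e3
  rw [h1] at e4
  simp only [phaseProd, if_true, Bool.false_eq_true, if_false, one_mul] at e1 e2 e3 e4
  have hΦ : phaseProd l W ≠ 0 := phaseProd_ne_zero l hnz W
  have h12 : ζ * θ₁ * f (run ((S, s, reg) : RegState r) (true :: W)) =
      θ₂ * f (run ((S, s, reg) : RegState r) (false :: W)) :=
    mul_left_cancel₀ hΦ (by linear_combination -e1 + e2)
  have h34 : ζ * θ₃ * f (run ((S, s, reg) : RegState r) (false :: W)) =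
      θ₄ * f (run ((S, s, reg) : RegState r) (true :: W)) :=
    mul_left_cancel₀ hΦ (by linear_combination -e3 + e4)
  have hθ₂sq : θ₂ * θ₂ = 1 := by rcases hθ₂ with rfl | rfl <;> norm_num
  have key : (ζ ^ 2 * (θ₁ * θ₂ * θ₃) - θ₄) * f (run ((S, s, reg) : RegState r) (true :: W)) = 0 := by
    linear_combination (ζ * θ₃ * θ₂) * h12
      + (ζ * θ₃ * f (run ((S, s, reg) : RegState r) (false :: W))) * hθ₂sq + h34
  obtain ⟨hz1, hz2⟩ := sq_ne_pm_one_of_cube hζ3 hζ1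
  have hne : ζ ^ 2 * (θ₁ * θ₂ * θ₃) - θ₄ ≠ 0 := by
    rcases hθ₁ with rfl | rfl <;> rcases hθ₂ with rfl | rfl <;> rcases hθ₃ with rfl | rfl <;>
      rcases hθ₄ with rfl | rfl <;>
      · intro h
        first
          | exact hz1 (by linear_combination h)
          | exact hz1 (by linear_combination -h)
          | exact hz2 (by linear_combination h)
          | exact hz2 (by linear_combination -h)
  exact (mul_eq_zero.1 key).resolve_left hne

/-- Cube roots of unity are unimodular. -/
theorem norm_eq_one_of_cube {z : ℂ} (hz : z ^ 3 = 1) : ‖z‖ = 1 := by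
  have h : ‖z‖ ^ 3 = 1 := by rw [← norm_pow, hz, norm_one]
  exact (pow_eq_one_iff_of_nonneg (norm_nonneg z) (by norm_num)).1 h

/-- **RIGIDITY of the block chain**: first phase a primitive cube root, `2r` later unimodular phases, arbitrary signs —
no nonzero `f` keeps its norm. -/
theorem chain_rigid {ζ : ℂ} (hζ3 : ζ ^ 3 = 1) (hζ1 : ζ ≠ 1) (e : RegState r → Bool → Bool)
    (l : List (ℂ × (RegState r → Bool → Bool))) (hl : l.length = 2 * r) (hl1 : ∀ p ∈ l, ‖p.1‖ = 1)
    (f : RegState r → ℂ) (heq : rnsq f ≤ rnsq (chainOp ((ζ, e) :: l) f)) : f = 0 := by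
  have hnorm : ∀ p ∈ (ζ, e) :: l, ‖p.1‖ ≤ 1 := by
    intro p hp
    simp only [List.mem_cons] at hp
    rcases hp with rfl | hp
    · exact (norm_eq_one_of_cube hζ3).le
    · exact (hl1 p hp).le
  have hal := chainAligned_of_le _ hnorm f heq
  have hnz : ∀ p ∈ l, p.1 ≠ 0 := fun p hp h => by simpa [h] using hl1 p hp
  funext τ
  obtain ⟨σ, bs, hbs, hrun⟩ := exists_run_eq (2 * r + 1) τ
  cases bs with
  | nil => simp at hbs
  | cons b W =>
    have hW : W.length = 2 * r := by simpa using hbs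
    obtain ⟨S, s, reg⟩ := σ
    rw [← hrun]
    cases b with
    | true => exact apply_run_eq_zero hζ3 hζ1 e l hl hnz f hal S s reg W hW
    | false =>
      rw [run_false_cons S s reg W (by omega)]
      exact apply_run_eq_zero hζ3 hζ1 e l hl hnz f hal S (!s) reg W hW

end BondTwist3

end Summit.QuantumAdvantage.AdviceFreeQNC0
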